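import Summits.BirchSwinnertonDyer.BirchSwinnertonDyer.Theorems.ManinLocalTwoThreeKummerCubeMonodromy
import Summits.BirchSwinnertonDyer.BirchSwinnertonDyer.Theorems.ManinLocalTwoThreeKummerCubeQExpansionPrinciple
import Summits.BirchSwinnertonDyer.BirchSwinnertonDyer.Theorems.ManinLocalTwoThreeKummerCubeSigmaLeaves
import Summits.BirchSwinnertonDyer.BirchSwinnertonDyer.Theorems.ManinLocalTwoThreeKummerCubeSigmaTangentLine
import Summits.BirchSwinnertonDyer.BirchSwinnertonDyer.Theorems.ManinLocalTwoThreeKummerCubeAnalyticDictionary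
import Summits.BirchSwinnertonDyer.BirchSwinnertonDyer.Theorems.ManinLocalTwoThreeCubeRootDescentClosed
import Summits.BirchSwinnertonDyer.BirchSwinnertonDyer.Theorems.ManinLocalTwoThreeKummerCubeSigmaMonodromy
import HarnessLib

/-!
# P79 `KummerCubeSeriesNotCubeAtThreeN` and G0 `KummerCubeSeriesNotCubeAtN` CLOSED — the σ-monodromy line assembled
# (route `ManinLocalTwoThree`, crux C3 `ManinPrimeToThreeAtNine` stmt-BirchSwinnertonDyer-22968; cell bsd-f2-manin, an g37, MEMO-an §80.9)

All seven leaves of `Rank1Residual/ManinAdditive/KummerCubeMonodromy.lean` are theorems in the tree —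
S1 `KummerCubeAnalytic.kummerCubeAnalyticDictionary`, S2 `KummerCubeSigmaLeaves.qExpansionCubeIdentityPrinciple`,
S3 `…sigmaTangentLineIdentity`, S3b `…sigmaCubeRootNotPeriodic`, S4 `…sigmaCubeRootMonodromy`, S6 `…shortThreeTorsionLift`,
S3′ `…tangentLineScaling` — so the kernel-checked compositions `KummerCubeMonodromy.kummerCubeSeriesNotCubeAtThreeN_of_monodromy`
/ `…AtN_of_monodromy` (`Theorems/ManinLocalTwoThreeKummerCubeMonodromy.lean`) give, BY NAME and with no hypothesis:

* `kummerCubeSeriesNotCubeAtThreeN : KummerCubeSeriesNotCubeAtThreeN` — **P79** = `stub_kummerCubeSeriesNotCubeAtThreeN`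
  of the registered C3 skeleton `Cruxes/ManinPrimeToThreeAtNine/Lines/kato_shift_three.lean` (v19, LEAD p1 g14);
* `kummerCubeSeriesNotCubeAtN : KummerCubeSeriesNotCubeAtN` — **G0**;
* through the landed `ManinLocalTwoThreeCubeRootDescentClosed` (p717770): **LAW₃** `CuspidalKummerCubeExponentLaw`,
  **LAW₃♮** `CuspidalKummerCubeExponentLawNonBlind` (C3 v18 `stub_cubeExponentLawNonBlind`), **N2** `NoNewmanCubeRootRepAtThreeN`,
  and NB₃ `NoBlindThreeTorsionOptimal ⟸ E-an-57` alone (`noBlindThreeTorsionOptimal_of_e57`).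

HONEST FRAMING / PARTITION: E-an-57 `CuspidalKummerCubeRepresentativeAtNine`, F₃♮, RES₃♭ and hence C3
`ManinPrimeToThreeAtNine`, C2, Manin's `c = 1` remain OPEN; PARTITION unchanged · beyond-print theorem: no (P79 is a
Manin-1972-Thm-1.9-type statement; the σ-monodromy proof route is the cell's) · BSD is not proved by this.
[cite: Manin1972, Thm. 1.9 (shape)] [cite: SilvermanAEC2009, III.8 (Weil pairing via σ; shape)]
-/

set_option autoImplicit false
-- lint-debt: the directory name repeats the summit name (sibling precedent `ManinLocalTwoThreeKummerCubeSigmaLeaves.lean`)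
set_option linter.dupNamespace false

noncomputable section

open Summit.BirchSwinnertonDyer.Rank1Residual.ManinAdditive.CuspidalKummer
open Summit.BirchSwinnertonDyer.Rank1Residual.ManinAdditive.CuspidalKummerThree
open Summit.BirchSwinnertonDyer.Rank1Residual.ManinAdditive.KummerCubeMonodromy
open Summit.BirchSwinnertonDyer.BirchSwinnertonDyer.Theorems.ManinLocalTwoThree.KummerCubeMonodromy
open Summit.BirchSwinnertonDyer.BirchSwinnertonDyer.Theorems.ManinLocalTwoThree.KummerCubeSigmaLeaves
open Summit.BirchSwinnertonDyer.BirchSwinnertonDyer.Theorems.ManinLocalTwoThree.KummerCubeAnalytic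
open Summit.BirchSwinnertonDyer.BirchSwinnertonDyer.Theorems.ManinLocalTwoThree.CubeRootDescent

namespace Summit.BirchSwinnertonDyer.BirchSwinnertonDyer.Theorems.ManinLocalTwoThree.KummerCubeNotCube

/-- **P79 — `KummerCubeSeriesNotCubeAtThreeN` holds.** [cite: Manin1972, Thm. 1.9 (shape); proof: the σ-monodromy line, MEMO-an §80] -/
theorem kummerCubeSeriesNotCubeAtThreeN : KummerCubeSeriesNotCubeAtThreeN :=
  kummerCubeSeriesNotCubeAtThreeN_of_monodromy kummerCubeAnalyticDictionary qExpansionCubeIdentityPrinciple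
    sigmaTangentLineIdentity sigmaCubeRootNotPeriodic sigmaCubeRootMonodromy shortThreeTorsionLift tangentLineScaling

/-- **G0 — `KummerCubeSeriesNotCubeAtN` holds.** [cite: Manin1972, Thm. 1.9 (shape); proof: the σ-monodromy line, MEMO-an §80] -/
theorem kummerCubeSeriesNotCubeAtN : KummerCubeSeriesNotCubeAtN :=
  kummerCubeSeriesNotCubeAtN_of_monodromy kummerCubeAnalyticDictionary qExpansionCubeIdentityPrinciple
    sigmaTangentLineIdentity sigmaCubeRootNotPeriodic sigmaCubeRootMonodromy shortThreeTorsionLift tangentLineScaling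

/-- **LAW₃ — `CuspidalKummerCubeExponentLaw` holds.** [folklore] -/
theorem cuspidalKummerCubeExponentLaw : CuspidalKummerCubeExponentLaw :=
  cuspidalKummerCubeExponentLaw_of_geometric kummerCubeSeriesNotCubeAtThreeN

/-- **LAW₃♮ — `CuspidalKummerCubeExponentLawNonBlind` holds** (C3 v18 `stub_cubeExponentLawNonBlind`). [folklore] -/
theorem cuspidalKummerCubeExponentLawNonBlind : CuspidalKummerCubeExponentLawNonBlind :=
  cuspidalKummerCubeExponentLawNonBlind_of_geometric kummerCubeSeriesNotCubeAtThreeN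

/-- **N2 — `NoNewmanCubeRootRepAtThreeN` holds.** [folklore] -/
theorem noNewmanCubeRootRepAtThreeN : NoNewmanCubeRootRepAtThreeN :=
  noNewmanCubeRootRepAtThreeN_of_geometric kummerCubeSeriesNotCubeAtThreeN

/-- **NB₃ ⟸ E-an-57 alone**: `CuspidalKummerCubeRepresentativeAtNine → NoBlindThreeTorsionOptimal`. [folklore] -/
theorem noBlindThreeTorsionOptimal_of_e57 (h57 : CuspidalKummerCubeRepresentativeAtNine) : NoBlindThreeTorsionOptimal :=
  noBlindThreeTorsionOptimal_of_geometric h57 kummerCubeSeriesNotCubeAtThreeN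

end Summit.BirchSwinnertonDyer.BirchSwinnertonDyer.Theorems.ManinLocalTwoThree.KummerCubeNotCube

end
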